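import Mathlib.Tactic.Group
import Literature.Topology.FourManifolds.BalancedPresentation
import HarnessLib

/-!
# Balanced presentations: stabilisation invariance, the Akbulut–Kirby family, and the
# fixed-rank formulation of the Andrews–Curtis conjecture (proofs)

Sibling proof file of `Literature/Topology/FourManifolds/BalancedPresentation.lean` (imported; its
statements are unchanged). It DISCHARGES the four dischargeable named facts of that file:

* `BalancedPresentation.presentsTrivialGroup_stabilize_holds` — stabilisation (the Tietze move
  "prolongation", Hog-Angeloni–Metzler 1993, Ch. I §2.3 (28)) preserves presenting the trivial
  group, via `BalancedPresentation.presentsTrivialGroup_stabilize_iff`;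
* `BalancedPresentation.presentsTrivialGroup_stabilizeBy_holds` — the iterated version;
* `BalancedPresentation.PresentsTrivialGroup.of_isStablyAndrewsCurtisEquivalent_holds` — stably
  Andrews–Curtis equivalent presentations present the trivial group simultaneously;
* `presentsTrivialGroup_akbulutKirby_holds` — the Akbulut–Kirby presentations
  `⟨x, y ∣ xᵏ⁺² = yᵏ⁺³, xyx = yxy⟩` present the trivial group (Akbulut–Kirby 1985;
  Hog-Angeloni–Metzler 1993, Ch. XII §1.1, Example c)), through the group-theoretic lemma
  `eq_one_of_braid_of_pow_eq_pow_succ` (`aba = bab ∧ aᴺ = bᴺ⁺¹ ⇒ a = b = 1`).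

It also records the normal form of stable Andrews–Curtis triviality
(`isStablyAndrewsCurtisEquivalent_trivial_iff`, using `BalancedPresentation.stabilizeBy_trivial`)
and the implication `andrewsCurtisConjecture_of_fixedRank` from the ORIGINAL fixed-rank
formulation of Andrews–Curtis (1965) — moves (T1)–(T3) only, no stabilisation (Ivanov 2018, §1;
Barmak 2018, p. 1) — to the stable formulation `AndrewsCurtisConjecture` vendored in the statement
file ("AC-conjecture with stabilizations", Ivanov 2018, §1; "weak version", Barmak 2018, p. 1;
"(AC)", Hog-Angeloni–Metzler 1993, Ch. I §4.1).

## What is NOT here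

`AndrewsCurtisConjecture` itself (and its fixed-rank original) is an OPEN PROBLEM — Andrews–Curtis
1965; Hog-Angeloni–Metzler 1993, Ch. I §4.1; Ivanov 2018, §1 ("remains unsettled"); Barmak 2018,
p. 1 ("All these three conjectures are open") — and is not asserted anywhere in the tree
(CONVENTIONS §4: open conjectures stay `def … : Prop`).

## References

* J. J. Andrews, M. L. Curtis, *Free groups and handlebodies*, Proc. AMS 16 (1965) 192–195.
  [AndrewsCurtis1965]
* C. Hog-Angeloni, W. Metzler, Chapters I and XII of *Two-dimensional homotopy and combinatorial
  group theory*, LMS Lecture Notes 197 (1993). [HogAngeloniMetzler1993]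
* S. V. Ivanov, *On conjectures of Andrews and Curtis*, Proc. AMS 146 (2018) 2283–2298.
  [Ivanov2018AndrewsCurtis]
* J. A. Barmak, *A counterexample to a strong version of the Andrews–Curtis conjecture*,
  arXiv:1806.11493 (2018). [Barmak2018StrongAC]
* S. Akbulut, R. Kirby, Topology 24 (1985) 375–390. [AkbulutKirby1985]
-/

noncomputable section

namespace Literature.Topology.FourManifolds

variable {n : ℕ}

namespace BalancedPresentation

/-- `FreeGroup.lift f (FreeGroup.map g x) = FreeGroup.lift (f ∘ g) x`. (Elementary.) [folklore] -/
theorem freeGroup_lift_map {α β G : Type*} [Group G] (f : β → G) (g : α → β) (x : FreeGroup α) :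
    FreeGroup.lift f (FreeGroup.map g x) = FreeGroup.lift (f ∘ g) x := by
  have h : (FreeGroup.lift f).comp (FreeGroup.map g) = FreeGroup.lift (f ∘ g) := by
    ext a
    simp [FreeGroup.map.of]
  exact DFunLike.congr_fun h x

/-- `FreeGroup.lift` of the generator classes of a presented group is the quotient map
`PresentedGroup.mk`. (Elementary.) [folklore] -/
theorem freeGroup_lift_presentedGroup_of {α : Type*} (rels : Set (FreeGroup α)) :
    FreeGroup.lift (PresentedGroup.of (rels := rels)) = PresentedGroup.mk rels := by
  ext a
  rw [FreeGroup.lift_apply_of]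
  rfl

/-- **Stabilisation preserves presenting the trivial group** (both directions). The assignment
`x_{castSucc i} ↦ xᵢ`, `xₙ ↦ 1` kills every relator of `P.stabilize`, hence defines a surjection
`P.stabilize.group → P.group`; and `xᵢ ↦ x_{castSucc i}` kills every relator of `P` and defines a
surjection `P.group → P.stabilize.group` (its image contains `xₙ = 1`). A surjection out of a
trivial group has trivial target. (Stabilisation = the Tietze move "prolongation",
Hog-Angeloni–Metzler 1993, Ch. I §2.3 (28); Andrews–Curtis 1965.)
[cite: HogAngeloniMetzler1993, Ch. I §2.3 (28)] -/
theorem presentsTrivialGroup_stabilize_iff (P : BalancedPresentation n) :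
    P.stabilize.PresentsTrivialGroup ↔ P.PresentsTrivialGroup := by
  set f : Fin (n + 1) → P.group :=
    Fin.lastCases (motive := fun _ ↦ P.group) 1 PresentedGroup.of with hf
  have hf_rel : ∀ r ∈ Set.range P.stabilize, FreeGroup.lift f r = 1 := by
    rintro _ ⟨j, rfl⟩
    cases j using Fin.lastCases with
    | last => simp [hf]
    | cast i =>
      have hfc : f ∘ Fin.castSucc = PresentedGroup.of := by
        funext i
        simp [hf]
      rw [stabilize_castSucc, freeGroup_lift_map, hfc, freeGroup_lift_presentedGroup_of]
      exact PresentedGroup.one_of_mem ⟨i, rfl⟩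
  set g : Fin n → P.stabilize.group := fun i ↦ PresentedGroup.of i.castSucc with hg
  have hg_rel : ∀ r ∈ Set.range P, FreeGroup.lift g r = 1 := by
    rintro _ ⟨i, rfl⟩
    have hgc : g = PresentedGroup.of ∘ Fin.castSucc := rfl
    rw [hgc, ← freeGroup_lift_map, freeGroup_lift_presentedGroup_of, ← stabilize_castSucc]
    exact PresentedGroup.one_of_mem ⟨i.castSucc, rfl⟩
  constructor
  · intro h
    have hsurj : Function.Surjective (PresentedGroup.toGroup hf_rel) := by
      rw [← MonoidHom.range_eq_top, eq_top_iff, ← PresentedGroup.closure_range_of,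
        Subgroup.closure_le]
      rintro _ ⟨i, rfl⟩
      exact ⟨PresentedGroup.of i.castSucc, by simp [hf]⟩
    haveI : Subsingleton P.stabilize.group := h
    exact hsurj.subsingleton
  · intro h
    have hsurj : Function.Surjective (PresentedGroup.toGroup hg_rel) := by
      rw [← MonoidHom.range_eq_top, eq_top_iff, ← PresentedGroup.closure_range_of,
        Subgroup.closure_le]
      rintro _ ⟨j, rfl⟩
      cases j using Fin.lastCases with
      | last =>
        have h1 : (PresentedGroup.of (Fin.last n) : P.stabilize.group) = 1 := by
          show PresentedGroup.mk _ (FreeGroup.of (Fin.last n)) = 1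
          rw [← stabilize_last P]
          exact PresentedGroup.one_of_mem ⟨Fin.last n, rfl⟩
        rw [h1]
        exact one_mem _
      | cast i => exact ⟨PresentedGroup.of i, by simp [hg]⟩
    haveI : Subsingleton P.group := h
    exact hsurj.subsingleton

/-- DISCHARGE of the named fact `presentsTrivialGroup_stabilize`. [folklore] -/
theorem presentsTrivialGroup_stabilize_holds : presentsTrivialGroup_stabilize (n := n) :=
  presentsTrivialGroup_stabilize_iff

/-- Iterated stabilisation preserves presenting the trivial group (induction on the number of
stabilisations). [folklore] -/
theorem presentsTrivialGroup_stabilizeBy_iff (P : BalancedPresentation n) (k : ℕ) :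
    (P.stabilizeBy k).PresentsTrivialGroup ↔ P.PresentsTrivialGroup := by
  induction k with
  | zero => rfl
  | succ k ih => rw [stabilizeBy_succ, presentsTrivialGroup_stabilize_iff, ih]

/-- DISCHARGE of the named fact `presentsTrivialGroup_stabilizeBy`. [folklore] -/
theorem presentsTrivialGroup_stabilizeBy_holds : presentsTrivialGroup_stabilizeBy (n := n) :=
  presentsTrivialGroup_stabilizeBy_iff

/-- Stably Andrews–Curtis equivalent presentations present the trivial group simultaneously.
[folklore] -/
theorem PresentsTrivialGroup.iff_of_isStablyAndrewsCurtisEquivalent {P Q : BalancedPresentation n}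
    (h : IsStablyAndrewsCurtisEquivalent P Q) : P.PresentsTrivialGroup ↔ Q.PresentsTrivialGroup := by
  obtain ⟨k, hk⟩ := h
  rw [← presentsTrivialGroup_stabilizeBy_iff P k, ← presentsTrivialGroup_stabilizeBy_iff Q k]
  exact PresentsTrivialGroup.of_isAndrewsCurtisEquivalent hk

/-- DISCHARGE of the named fact `PresentsTrivialGroup.of_isStablyAndrewsCurtisEquivalent`.
[folklore] -/
theorem PresentsTrivialGroup.of_isStablyAndrewsCurtisEquivalent_holds :
    PresentsTrivialGroup.of_isStablyAndrewsCurtisEquivalent (n := n) :=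
  fun {_ _} h ↦ PresentsTrivialGroup.iff_of_isStablyAndrewsCurtisEquivalent h

/-- Stabilising the trivial presentation gives the trivial presentation on one more generator.
[folklore] -/
@[simp] theorem stabilize_trivial (n : ℕ) : (trivial n).stabilize = trivial (n + 1) := by
  funext j
  cases j using Fin.lastCases with
  | last => simp [trivial]
  | cast i => simp [trivial, FreeGroup.map.of]

/-- Stabilising the trivial presentation `k` times gives the trivial presentation, pointwise form.
[folklore] -/
theorem stabilizeBy_trivial_apply (n : ℕ) :
    ∀ (k : ℕ) (j : Fin (n + k)), (trivial n).stabilizeBy k j = FreeGroup.of j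
  | 0, j => rfl
  | k + 1, j => by
    rw [stabilizeBy_succ]
    cases j using Fin.lastCases with
    | last => simp
    | cast i => simp [stabilizeBy_trivial_apply n k i, FreeGroup.map.of]

/-- Stabilising the trivial presentation `k` times gives the trivial presentation on `n + k`
generators. [folklore] -/
@[simp] theorem stabilizeBy_trivial (n k : ℕ) : (trivial n).stabilizeBy k = trivial (n + k) :=
  funext (stabilizeBy_trivial_apply n k)

end BalancedPresentation

/-- **Normal form of stable Andrews–Curtis triviality**: `P` is stably Andrews–Curtis equivalent
to the trivial presentation iff some stabilisation `P.stabilizeBy k` is Andrews–Curtis equivalent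
(at fixed rank `n + k`) to the trivial presentation on `n + k` generators — the form "(T1)–(T3)
after finitely many stabilisations (T4)" of the conjecture with stabilisations (Ivanov 2018, §1).
[folklore] -/
theorem isStablyAndrewsCurtisEquivalent_trivial_iff (P : BalancedPresentation n) :
    IsStablyAndrewsCurtisEquivalent P (BalancedPresentation.trivial n) ↔
      ∃ k : ℕ, IsAndrewsCurtisEquivalent (P.stabilizeBy k) (BalancedPresentation.trivial (n + k)) := by
  simp only [IsStablyAndrewsCurtisEquivalent, BalancedPresentation.stabilizeBy_trivial]

/-- **The original fixed-rank formulation implies the stable one.** Andrews–Curtis (1965) conjectured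
that every balanced presentation of the trivial group can be brought to the trivial presentation
by the moves (T1) `rᵢ ↦ rᵢ⁻¹`, (T2) `rᵢ ↦ rᵢ rⱼ`, (T3) `rᵢ ↦ w rᵢ w⁻¹` *at fixed rank* (Ivanov 2018,
§1, display (1.1) and the sentence following it; Barmak 2018, p. 1: "Q-equivalent [1]"); the
statement `AndrewsCurtisConjecture` of this file additionally allows stabilisations ("AC-conjecture
with stabilizations", Ivanov 2018, §1 (T4); "weak version", Barmak 2018, p. 1; "(AC)" of
Hog-Angeloni–Metzler 1993, Ch. I §4.1) and is therefore implied by the original one (take `k = 0`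
stabilisations). Both are open. The hypothesis is spelled out rather than named, since an open
conjecture is never asserted. [cite: Ivanov2018AndrewsCurtis, §1] -/
theorem andrewsCurtisConjecture_of_fixedRank
    (h : ∀ (n : ℕ) (P : BalancedPresentation n),
      P.PresentsTrivialGroup → IsAndrewsCurtisEquivalent P (BalancedPresentation.trivial n)) :
    AndrewsCurtisConjecture :=
  fun n P hP ↦ ⟨0, h n P hP⟩

/-- In a group, the Akbulut–Kirby relations `a b a = b a b` and `aᴺ = bᴺ⁺¹` force `a = b = 1`:
`c = ab` conjugates `a` to `b` (`c a c⁻¹ = b` by the braid relation), so `c aᴺ c⁻¹ = bᴺ`; but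
`aᴺ = bᴺ⁺¹` commutes with `a` and with `b`, hence with `c`, so `bᴺ = aᴺ = bᴺ⁺¹`, `b = 1`, and then
`a² = a`. (Akbulut–Kirby 1985; Hog-Angeloni–Metzler 1993, Ch. XII §1.1, Example c): "The
presentations `⟨a, b ∣ aba = bab, aⁿ = bⁿ⁺¹⟩` all yield the trivial group.")
[cite: HogAngeloniMetzler1993, Ch. XII §1.1 (1c)] -/
theorem eq_one_of_braid_of_pow_eq_pow_succ {G : Type*} [Group G] {a b : G} {N : ℕ}
    (h₁ : a ^ N = b ^ (N + 1)) (h₂ : a * b * a = b * a * b) : a = 1 ∧ b = 1 := by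
  have hconj : a * b * a * (a * b)⁻¹ = b := by
    rw [h₂]
    group
  have hpow : a * b * a ^ N * (a * b)⁻¹ = b ^ N := by
    rw [← conj_pow, hconj]
  have hcomm : Commute (a * b) (a ^ N) :=
    (Commute.self_pow a N).mul_left (by rw [h₁]; exact Commute.self_pow b (N + 1))
  have hbN : b ^ N = a ^ N := by
    rw [← hpow, hcomm.eq, mul_inv_cancel_right]
  have hb : b = 1 := by
    have h3 : b ^ N * b = b ^ N * 1 := by
      rw [mul_one, ← pow_succ, ← h₁, hbN]
    exact mul_left_cancel h3
  subst hb
  refine ⟨?_, rfl⟩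
  simpa using h₂

/-- The first Akbulut–Kirby relator is `xᵏ⁺² (yᵏ⁺³)⁻¹`. (Definitional.) [folklore] -/
theorem akbulutKirby_zero (k : ℕ) :
    akbulutKirby k 0 = FreeGroup.of 0 ^ (k + 2) * (FreeGroup.of 1 ^ (k + 3))⁻¹ := rfl

/-- The second Akbulut–Kirby relator is `x y x (y x y)⁻¹`. (Definitional.) [folklore] -/
theorem akbulutKirby_one (k : ℕ) :
    akbulutKirby k 1 = FreeGroup.of 0 * FreeGroup.of 1 * FreeGroup.of 0 *
      (FreeGroup.of 1 * FreeGroup.of 0 * FreeGroup.of 1)⁻¹ := rfl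

/-- **The Akbulut–Kirby presentations `⟨x, y ∣ xᵏ⁺² = yᵏ⁺³, xyx = yxy⟩` present the trivial
group**: both generators die by `eq_one_of_braid_of_pow_eq_pow_succ`, and the generators generate.
(Akbulut–Kirby 1985; Hog-Angeloni–Metzler 1993, Ch. XII §1.1, Example c).)
[cite: HogAngeloniMetzler1993, Ch. XII §1.1 (1c)] -/
theorem presentsTrivialGroup_akbulutKirby_of (k : ℕ) : (akbulutKirby k).PresentsTrivialGroup := by
  have h₁ : (PresentedGroup.of 0 : PresentedGroup (Set.range (akbulutKirby k))) ^ (k + 2) =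
      PresentedGroup.of 1 ^ (k + 3) := by
    have h := PresentedGroup.one_of_mem (rels := Set.range (akbulutKirby k)) ⟨0, rfl⟩
    rw [akbulutKirby_zero, map_mul, map_inv, map_pow, map_pow] at h
    exact mul_inv_eq_one.1 h
  have h₂ : (PresentedGroup.of 0 : PresentedGroup (Set.range (akbulutKirby k))) *
      PresentedGroup.of 1 * PresentedGroup.of 0 =
      PresentedGroup.of 1 * PresentedGroup.of 0 * PresentedGroup.of 1 := by
    have h := PresentedGroup.one_of_mem (rels := Set.range (akbulutKirby k)) ⟨1, rfl⟩
    rw [akbulutKirby_one, map_mul, map_inv, map_mul, map_mul, map_mul, map_mul] at h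
    exact mul_inv_eq_one.1 h
  obtain ⟨ha, hb⟩ := eq_one_of_braid_of_pow_eq_pow_succ h₁ h₂
  have hgen : ∀ j : Fin 2,
      (PresentedGroup.of j : PresentedGroup (Set.range (akbulutKirby k))) ∈ (⊥ : Subgroup _) :=
    Fin.forall_fin_two.2 ⟨by simpa using ha, by simpa using hb⟩
  have hall : ∀ x : PresentedGroup (Set.range (akbulutKirby k)), x = 1 := fun x ↦
    (Subgroup.mem_bot).1 (PresentedGroup.generated_by _ ⊥ hgen x)
  exact subsingleton_of_forall_eq 1 hall

/-- DISCHARGE of the named fact `presentsTrivialGroup_akbulutKirby`. [folklore] -/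
theorem presentsTrivialGroup_akbulutKirby_holds : presentsTrivialGroup_akbulutKirby :=
  presentsTrivialGroup_akbulutKirby_of

end Literature.Topology.FourManifolds
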